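import Summits.ResolutionOfSingularities.ResolutionOfSingularities.Theorems.EquisingularLiftEquisingularLiftNatCompleteIntersectionLiftCentre
import Summits.ResolutionOfSingularities.ResolutionOfSingularities.Theorems.EquisingularLiftEquisingularLiftNatCompleteIntersectionLiftProj
import Summits.ResolutionOfSingularities.ResolutionOfSingularities.Theorems.EquisingularLiftEquisingularLiftNatLinearCentre
import Summits.ResolutionOfSingularities.ResolutionOfSingularities.Theorems.EquisingularLiftEquisingularLiftGoodAtOfSmooth
import HarnessLib

/-!
# [OURS · L1 W4.5(b) · EL♮(3)] T-LIFT-CI, part 4 (THE NOSE): the complete-intersection lift `C = (F̃₁,…,F̃_c)~ ⊂ ℙⁿ_O` of a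
# TRANSVERSALLY cut `V₊(f) ⊂ ℙⁿ_k` is a REGULAR scheme, FLAT over `Spec O` — clauses (b), (c) of the HorizChainE1 nose step

Cell `res-hironaka`, rung L, slot W4.5(b); crux **EL♮(3)** (stmt-ResolutionOfSingularities-20148), registered stub `stub_elnat_ciNoseThenPoints`
(res-L1-w45b-lead-2 RESHAPE v6, 2026-08-27T08:54:27Z); CUT (L1) T-LIFT-CI of res-D-pv-027 AS res-L1-s36-pv-4. OURS; NOT a statement of any
manuscript; AI-written, weaker than expert review. No definition, no `sorry`, standard axioms. `--supports stmt-ResolutionOfSingularities-20148 --as helper`.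
Parts 1–3: `…NatCompleteIntersectionLiftAlgebra` (p517176, ring core), `…NatCompleteIntersectionLiftCentre` (p518941, ambient-free centre criterion),
`…NatCompleteIntersectionLiftProj` (p518108, `C` def-free as the tree's `projIdealSheaf`, stalk generators, base change).

* `stalkMap_germ_mk₁` — along `g = Proj φ : ℙⁿ_k → ℙⁿ_O` the stalk map at `y` sends the germ at `g y` of `F̃/x_iᵐ` to the germ at `y` of
  `φ(F̃)/x_iᵐ` (Mathlib `germ_stalkMap_apply`, tree `projMap_app_awayToSection`, `Away.map_mk`; the chart elements `φ(x_i) = x_i` are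
  identified by substitution).
* **`isRegular_and_flat_ciNose`** — `O` a DVR with uniformiser `ϖ`, `π : O ↠ k` onto a field with `π ϖ = 0`, `φ` the graded coefficient map,
  `F̃_l` homogeneous of degrees `d_l` with reductions `f_l`; HYPOTHESIS (J′): at every point `y` of `supp (f)~` some standard chart `D₊(x_i) ∋ y`
  has «`Σ b_l·germ_y(f_l/x_i^{d_l}) ∈ 𝔪_y² ⇒ b_l ∈ 𝔪_y`» (the stalk-level transversality of `V₊(f)`; it follows from the Jacobian-minor
  clause of the registered stub by Euler's identity and part 1 §3 — brick (J) ⇒ (J′), separate). CONCLUSION: `V(C)` is REGULAR and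
  `V(C) → ℙⁿ_O → Spec O` is FLAT. Proof: part 2's `isRegular_and_flat_of_cotangentLift`; the special points of `V(C)` are `g(supp (f)~)`
  (base change `comap_projIdealSheaf_span`, Mathlib `support_comap`, `LinearCentre.range_projMap_eq_specialFibre`); good reduction of
  `ℙⁿ_O` (`stub_goodAtOfSmooth` ∘ `stub_projectiveAmbientSmoothProper`); stalk generators (`stalkIdeal_projIdealSheaf_span`); the
  downstairs hypothesis transported along the surjective stalk map of the closed immersion `g` (part 1 `downstairs_of_surjective`), which
  kills `ϖ` because `g ≫ q = q_k ≫ Spec π` (`ProjectiveAmbientFibre.isPullback_projMap`) and `π ϖ = 0`.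

What remains for the instance of `stub_elnat_ciNoseThenPoints` (stated plainly): the SMOOTH upgrade of (b)+(c) (051's currency; flat + fibres
regular, Literature 01V8), the hKEY clause «`(f)~ = vanishingIdeal ⟨Σ,_⟩`» (stalkwise radicality), and the brick (J) ⇒ (J′).

References: Matsumura (1986) Thms. 14.2, 14.3 [Matsumura1987]; Hartshorne (1977) II Prop. 5.9, III Prop. 9.7 [Hartshorne1977]; Liu (2002)
Prop. 3.1.9 [Liu2002]; cell: TARGET-CINOSE / skeleton v6 (lead-2).
-/

set_option linter.dupNamespace false -- mandated namespace `Summit.<Summit>.<Problem>` of this single-conjunct summit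
set_option linter.overlappingInstances false -- signatures carry `[IsDomain O] [IsDiscreteValuationRing O]`

noncomputable section

open CategoryTheory AlgebraicGeometry TopologicalSpace IsLocalRing Opposite
open MvPolynomial HomogeneousLocalization
open Literature.AlgebraicGeometry.Resolution
open Summit.ResolutionOfSingularities.ResolutionOfSingularities.Cruxes.EquisingularLift.StrataSplit

attribute [local instance] MvPolynomial.gradedAlgebra

namespace Summit.ResolutionOfSingularities.ResolutionOfSingularities.Cruxes.EquisingularLiftNat.Sections

namespace CILift

/-! ## The complete-intersection nose on `ℙⁿ_O` is REGULAR and `O`-FLAT -/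

section Nose

variable (O : Type) [CommRing O] [IsDomain O] [IsDiscreteValuationRing O]

omit [IsDomain O] [IsDiscreteValuationRing O] in
/-- Germs of dehomogenised forms match along `g = Proj φ`: the stalk map of `g` at `y` sends the germ at `g y` of `F̃_l/x_iᵈ` to the
germ at `y` of `f_l/x_iᵈ` (`f_l = φ F̃_l`, `φ x_i = x_i`). Plumbing over Mathlib `germ_stalkMap_apply`, `Proj.awayToSection_comp_appLE`,
`Away.map_mk`. [folklore] -/
theorem stalkMap_germ_mk₁ {k : Type} [CommRing k] {n : ℕ}
    (φ : (homogeneousSubmodule (Fin (n + 1)) O) →+*ᵍ (homogeneousSubmodule (Fin (n + 1)) k))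
    (hφ' : HomogeneousIdeal.irrelevant (homogeneousSubmodule (Fin (n + 1)) k) ≤
      (HomogeneousIdeal.irrelevant (homogeneousSubmodule (Fin (n + 1)) O)).map φ)
    (i : Fin (n + 1)) (hφX : φ (X i) = X i) (m : ℕ) (a : MvPolynomial (Fin (n + 1)) O)
    (ha : a ∈ homogeneousSubmodule (Fin (n + 1)) O m) (b : MvPolynomial (Fin (n + 1)) k)
    (hb : b ∈ homogeneousSubmodule (Fin (n + 1)) k m) (hab : φ a = b)
    (y : Proj (homogeneousSubmodule (Fin (n + 1)) k))
    (hyi : y ∈ Proj.basicOpen (homogeneousSubmodule (Fin (n + 1)) k) (X i))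
    (hgy : Proj.map φ hφ' y ∈ Proj.basicOpen (homogeneousSubmodule (Fin (n + 1)) O) (X i)) :
    ((Proj.map φ hφ').stalkMap y).hom
        (((Proj (homogeneousSubmodule (Fin (n + 1)) O)).presheaf.germ
            (Proj.basicOpen (homogeneousSubmodule (Fin (n + 1)) O) (X i)) (Proj.map φ hφ' y) hgy).hom
          ((Proj.awayToSection (homogeneousSubmodule (Fin (n + 1)) O) (X i)).hom
            (mk₁ (homogeneousSubmodule (Fin (n + 1)) O) (X_mem_one' i) m a ha))) =
      ((Proj (homogeneousSubmodule (Fin (n + 1)) k)).presheaf.germ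
          (Proj.basicOpen (homogeneousSubmodule (Fin (n + 1)) k) (X i)) y hyi).hom
        ((Proj.awayToSection (homogeneousSubmodule (Fin (n + 1)) k) (X i)).hom
          (mk₁ (homogeneousSubmodule (Fin (n + 1)) k) (X_mem_one' i) m b hb)) := by
  have hXO : (X i : MvPolynomial (Fin (n + 1)) O) ∈ (homogeneousSubmodule (Fin (n + 1)) O) 1 := X_mem_one' i
  have hXk : φ (X i) ∈ (homogeneousSubmodule (Fin (n + 1)) k) 1 := φ.map_mem hXO
  rw [Scheme.Hom.germ_stalkMap_apply]
  -- the pulled-back section over `g⁻¹ D₊(x_i) = D₊(φ x_i)`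
  have happ : ((Proj.map φ hφ').app (Proj.basicOpen (homogeneousSubmodule (Fin (n + 1)) O) (X i))).hom
        ((Proj.awayToSection (homogeneousSubmodule (Fin (n + 1)) O) (X i)).hom
          (mk₁ (homogeneousSubmodule (Fin (n + 1)) O) hXO m a ha)) =
      (Proj.awayToSection (homogeneousSubmodule (Fin (n + 1)) k) (φ (X i))).hom
        (mk₁ (homogeneousSubmodule (Fin (n + 1)) k) hXk m b hb) := by
    rw [projMap_app_awayToSection φ hφ' hXO]
    congr 1
    apply val_injective
    rw [mk₁, Away.map_mk, val_mk₁, Away.val_mk]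
    congr 1
  rw [happ]
  -- `D₊(φ x_i) = D₊(x_i)`: generalise over the chart element and substitute
  suffices h : ∀ (t : MvPolynomial (Fin (n + 1)) k) (ht : t ∈ (homogeneousSubmodule (Fin (n + 1)) k) 1)
      (heq : t = X i) (hyt : y ∈ Proj.basicOpen (homogeneousSubmodule (Fin (n + 1)) k) t),
      ((Proj (homogeneousSubmodule (Fin (n + 1)) k)).presheaf.germ
          (Proj.basicOpen (homogeneousSubmodule (Fin (n + 1)) k) t) y hyt).hom
        ((Proj.awayToSection (homogeneousSubmodule (Fin (n + 1)) k) t).hom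
          (mk₁ (homogeneousSubmodule (Fin (n + 1)) k) ht m b hb)) =
      ((Proj (homogeneousSubmodule (Fin (n + 1)) k)).presheaf.germ
          (Proj.basicOpen (homogeneousSubmodule (Fin (n + 1)) k) (X i)) y hyi).hom
        ((Proj.awayToSection (homogeneousSubmodule (Fin (n + 1)) k) (X i)).hom
          (mk₁ (homogeneousSubmodule (Fin (n + 1)) k) (X_mem_one' i) m b hb)) from
    h (φ (X i)) hXk hφX hgy
  intro t ht heq hyt
  subst heq
  rfl

/-- **T-LIFT-CI, centre clauses: the COMPLETE-INTERSECTION NOSE `C = (F̃₁,…,F̃_c)~ ⊂ ℙⁿ_O` IS A REGULAR SCHEME, FLAT OVER `Spec O`.**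
`O` a DVR with uniformiser `ϖ`, `π : O ↠ k` onto a field with `π ϖ = 0`, `φ` the graded coefficient map (`φ s = map π s`), `F̃_l`
homogeneous of degree `d_l` with reductions `f_l`. HYPOTHESIS (J′) (the chartwise, stalk-level form of «`V₊(f)` is cut out TRANSVERSALLY»,
supplied from the Jacobian-minor clause of `stub_elnat_ciNoseThenPoints` by Euler's identity and part 1's `downstairs_of_jacobian`):
at every point `y` of the support of `(f)~` there is a standard chart `D₊(x_i) ∋ y` on which the germs of the `f_l/x_i^{d_l}` satisfy
«`Σ b_l · germ ∈ 𝔪_y² ⇒ b_l ∈ 𝔪_y`». CONCLUSION: clauses (b) «`V(C)` regular» and (c) «`V(C) → ℙⁿ_O → Spec O` flat» of the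
HorizChainE1 step along `C` — by part 2's `isRegular_and_flat_of_cotangentLift` at the points `g(y)` (the special points of `V(C)` are
exactly `g(supp (f)~)`: base change `comap_projIdealSheaf_span` + `range_projMap_eq_specialFibre`), good reduction of `ℙⁿ_O`
(`stub_goodAtOfSmooth`), stalk generators (`stalkIdeal_projIdealSheaf_span`) and part 1's `downstairs_of_surjective` along the surjective
stalk map of the closed immersion `g` (which kills `ϖ`: `ℙⁿ_k = ℙⁿ_O ×_O k`, `ProjectiveAmbientFibre.isPullback_projMap`).
[cite: Matsumura1987, Thm. 14.2; Hartshorne1977, III Prop. 9.7; Liu2002, Prop. 3.1.9] -/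
theorem isRegular_and_flat_ciNose (ϖ : O) (hϖ : Irreducible ϖ) {k : Type} [Field k] (π : O →+* k)
    (hπ : Function.Surjective π) (hπϖ : π ϖ = 0) {n c : ℕ}
    (φ : (homogeneousSubmodule (Fin (n + 1)) O) →+*ᵍ (homogeneousSubmodule (Fin (n + 1)) k))
    (hφ' : HomogeneousIdeal.irrelevant (homogeneousSubmodule (Fin (n + 1)) k) ≤
      (HomogeneousIdeal.irrelevant (homogeneousSubmodule (Fin (n + 1)) O)).map φ)
    (hφ : ∀ s, φ s = MvPolynomial.map π s)
    (F : Fin c → MvPolynomial (Fin (n + 1)) O) (f : Fin c → MvPolynomial (Fin (n + 1)) k) (d : Fin c → ℕ)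
    (hF : ∀ l, F l ∈ homogeneousSubmodule (Fin (n + 1)) O (d l)) (hf : ∀ l, f l ∈ homogeneousSubmodule (Fin (n + 1)) k (d l))
    (hFf : ∀ l, MvPolynomial.map π (F l) = f l)
    (hJ : ∀ y ∈ (projIdealSheaf (homogeneousSubmodule (Fin (n + 1)) k)
        ⟨Ideal.span (Set.range f), isHomogeneous_span_of_forall_mem _ f d hf⟩).support,
      ∃ (i : Fin (n + 1)) (hyi : y ∈ Proj.basicOpen (homogeneousSubmodule (Fin (n + 1)) k) (X i)),
        ∀ b : Fin c → (Proj (homogeneousSubmodule (Fin (n + 1)) k)).presheaf.stalk y,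
          ∑ l, b l * ((Proj (homogeneousSubmodule (Fin (n + 1)) k)).presheaf.germ
              (Proj.basicOpen (homogeneousSubmodule (Fin (n + 1)) k) (X i)) y hyi).hom
            ((Proj.awayToSection (homogeneousSubmodule (Fin (n + 1)) k) (X i)).hom
              (mk₁ (homogeneousSubmodule (Fin (n + 1)) k) (X_mem_one' i) (d l) (f l) (hf l))) ∈
            maximalIdeal ((Proj (homogeneousSubmodule (Fin (n + 1)) k)).presheaf.stalk y) ^ 2 →
          ∀ l, b l ∈ maximalIdeal ((Proj (homogeneousSubmodule (Fin (n + 1)) k)).presheaf.stalk y)) :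
    Scheme.IsRegular (projIdealSheaf (homogeneousSubmodule (Fin (n + 1)) O)
        ⟨Ideal.span (Set.range F), isHomogeneous_span_of_forall_mem _ F d hF⟩).subscheme ∧
      Flat ((projIdealSheaf (homogeneousSubmodule (Fin (n + 1)) O)
          ⟨Ideal.span (Set.range F), isHomogeneous_span_of_forall_mem _ F d hF⟩).subschemeι ≫
        Proj.toSpecZero (homogeneousSubmodule (Fin (n + 1)) O) ≫
          Spec.map (CommRingCat.ofHom (algebraMap O ((homogeneousSubmodule (Fin (n + 1)) O) 0)))) := by
  set C := projIdealSheaf (homogeneousSubmodule (Fin (n + 1)) O)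
    ⟨Ideal.span (Set.range F), isHomogeneous_span_of_forall_mem _ F d hF⟩ with hC
  set q := Proj.toSpecZero (homogeneousSubmodule (Fin (n + 1)) O) ≫
    Spec.map (CommRingCat.ofHom (algebraMap O ((homogeneousSubmodule (Fin (n + 1)) O) 0))) with hq
  set g := Proj.map φ hφ' with hg
  have hφX : ∀ i : Fin (n + 1), φ (X i) = X i := fun i => by rw [hφ, map_X]
  have hφF : ∀ l, φ (F l) = f l := fun l => by rw [hφ, hFf]
  obtain ⟨hsm, hpr⟩ := Summit.ResolutionOfSingularities.ResolutionOfSingularities.Cruxes.EquisingularLift.StrataSplit.stub_projectiveAmbientSmoothProper O n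
  haveI : IsLocallyNoetherian (Proj (homogeneousSubmodule (Fin (n + 1)) O)) := by
    haveI := hsm
    exact LocallyOfFiniteType.isLocallyNoetherian q
  haveI := hpr
  haveI : UniversallyClosed (C.subschemeι ≫ q) := inferInstance
  haveI : IsClosedImmersion g :=
    Literature.AlgebraicGeometry.FundamentalGroup.isClosedImmersion_projMap_of_surjective φ hφ'
      (fun s => by obtain ⟨t, ht⟩ := MvPolynomial.map_surjective π hπ s; exact ⟨t, (hφ t).trans ht⟩)
  refine isRegular_and_flat_of_cotangentLift O q C ϖ hϖ fun x hxC hx => ?_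
  -- `x = g y` with `y ∈ supp (f)~`
  have hxr : x ∈ Set.range g := by
    rw [hg, Summit.ResolutionOfSingularities.ResolutionOfSingularities.Cruxes.EquisingularLiftNat.LinearCentre.range_projMap_eq_specialFibre π hπ φ hφ hφ']
    exact hx
  obtain ⟨y, rfl⟩ := hxr
  have hy : y ∈ (projIdealSheaf (homogeneousSubmodule (Fin (n + 1)) k)
      ⟨Ideal.span (Set.range f), isHomogeneous_span_of_forall_mem _ f d hf⟩).support := by
    rw [← comap_projIdealSheaf_span φ hφ' hφX F f d hF hf hφF, Scheme.IdealSheafData.support_comap]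
    exact hxC
  obtain ⟨i, hyi, hJy⟩ := hJ y hy
  have hgyi : g y ∈ Proj.basicOpen (homogeneousSubmodule (Fin (n + 1)) O) (X i) := by
    change y ∈ g ⁻¹ᵁ Proj.basicOpen (homogeneousSubmodule (Fin (n + 1)) O) (X i)
    rw [hg, Proj.map_preimage_basicOpen, hφX]
    exact hyi
  obtain ⟨hreg, hgood⟩ := Summit.ResolutionOfSingularities.ResolutionOfSingularities.Cruxes.EquisingularLift.StrataSplit.stub_goodAtOfSmooth O _ q hsm (g y)
  refine ⟨hreg, hgood ϖ hϖ, c, fun l =>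
    ((Proj (homogeneousSubmodule (Fin (n + 1)) O)).presheaf.germ
        (Proj.basicOpen (homogeneousSubmodule (Fin (n + 1)) O) (X i)) (g y) hgyi).hom
      ((Proj.awayToSection (homogeneousSubmodule (Fin (n + 1)) O) (X i)).hom
        (mk₁ (homogeneousSubmodule (Fin (n + 1)) O) (X_mem_one' i) (d l) (F l) (hF l))),
    stalkIdeal_projIdealSheaf_span F d hF i (g y) hgyi, fun l => ?_, ?_⟩
  · -- the generators lie in `𝔪_{g y}` since `g y ∈ supp C`
    have hle := (mem_support_iff_stalkIdeal_le C (g y)).mp hxC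
    rw [hC, stalkIdeal_projIdealSheaf_span F d hF i (g y) hgyi] at hle
    exact hle (Ideal.subset_span ⟨l, rfl⟩)
  · -- the downstairs hypothesis, transported along the (surjective) stalk map of `g`
    refine downstairs_of_surjective (g.stalkMap y).hom (g.stalkMap_surjective y) ?_ ?_
    · -- `g` kills `ϖ`: `g ≫ q = q_k ≫ Spec π` and `π ϖ = 0`
      have hP := ProjectiveAmbientFibre.isPullback_projMap π φ hφ hπ hφ'
      rw [Summit.ResolutionOfSingularities.ResolutionOfSingularities.Cruxes.EquisingularLift.StrataSplit.stalkMap_Γgerm_apply' g y]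
      set qk : Proj (homogeneousSubmodule (Fin (n + 1)) k) ⟶ Spec (.of k) :=
        Proj.toSpecZero (homogeneousSubmodule (Fin (n + 1)) k) ≫
          Spec.map (CommRingCat.ofHom (algebraMap k ((homogeneousSubmodule (Fin (n + 1)) k) 0))) with hqk
      set sϖ : Γ(Spec (.of O), ⊤) := (Scheme.ΓSpecIso (.of O)).inv.hom ϖ with hsϖ
      have hw : g ≫ q = qk ≫ Spec.map (CommRingCat.ofHom π) := by rw [hg, hq, hqk]; exact hP.w
      have hcomp : g.appTop.hom (q.appTop.hom sϖ) = qk.appTop.hom ((Spec.map (CommRingCat.ofHom π)).appTop.hom sϖ) := by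
        have h1 : g.appTop.hom (q.appTop.hom sϖ) = (g ≫ q).appTop.hom sϖ := rfl
        have h2 : qk.appTop.hom ((Spec.map (CommRingCat.ofHom π)).appTop.hom sϖ) =
            (qk ≫ Spec.map (CommRingCat.ofHom π)).appTop.hom sϖ := rfl
        rw [h1, h2, hw]
      have h0 : (Spec.map (CommRingCat.ofHom π)).appTop.hom sϖ = 0 := by
        rw [hsϖ]
        have hnat := congrArg (fun ψ => ψ.hom ϖ) (Scheme.ΓSpecIso_inv_naturality (CommRingCat.ofHom π))
        simp only [CommRingCat.hom_comp, RingHom.comp_apply, CommRingCat.hom_ofHom] at hnat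
        rw [← hnat, hπϖ, map_zero]
      rw [hcomp, h0, map_zero, map_zero]
    · intro b hb l
      have himg : ∀ l, (g.stalkMap y).hom
          (((Proj (homogeneousSubmodule (Fin (n + 1)) O)).presheaf.germ
              (Proj.basicOpen (homogeneousSubmodule (Fin (n + 1)) O) (X i)) (g y) hgyi).hom
            ((Proj.awayToSection (homogeneousSubmodule (Fin (n + 1)) O) (X i)).hom
              (mk₁ (homogeneousSubmodule (Fin (n + 1)) O) (X_mem_one' i) (d l) (F l) (hF l)))) =
          ((Proj (homogeneousSubmodule (Fin (n + 1)) k)).presheaf.germ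
              (Proj.basicOpen (homogeneousSubmodule (Fin (n + 1)) k) (X i)) y hyi).hom
            ((Proj.awayToSection (homogeneousSubmodule (Fin (n + 1)) k) (X i)).hom
              (mk₁ (homogeneousSubmodule (Fin (n + 1)) k) (X_mem_one' i) (d l) (f l) (hf l))) := fun l =>
        stalkMap_germ_mk₁ O φ hφ' i (hφX i) (d l) (F l) (hF l) (f l) (hf l) (hφF l) y hyi hgyi
      simp only [himg] at hb
      exact hJy b hb l

end Nose

end CILift

end Summit.ResolutionOfSingularities.ResolutionOfSingularities.Cruxes.EquisingularLiftNat.Sections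

end
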